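import Summits.HodgeConjecture.HodgeConjecture.Theorems.PadicSemiregularLiftHodgeFermatVarietiesReachCoprimeSix
import HarnessLib

/-!
# Four pairs and Aoki's `σ_{7,A}` are reachable at their own level — stub G8-R `stub_reach_of_pairedOrSigmaSeven` of line `cancel-by-any-claim-lattice`, crux `HodgeFermatVarieties` (stmt-HodgeConjecture-1334)

Crux `HodgeFermatVarieties` (stmt-HodgeConjecture-1334), line `cancel-by-any-claim-lattice`, stub G8-R
`stub_reach_of_pairedOrSigmaSeven` (programme G8 of the lead, "the Hodge octuples at a level prime to
`30` with `49 ∤ m` are four pairs or `σ_{7,A}`"). THIS FILE: both shapes are ℤ-reachable from the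
printed supply AT THEIR OWN LEVEL (`k = 1`, no level change) — the word-for-word `7`-analogue of
`PadicSemiregularLiftHodgeFermatVarietiesReachCoprimeSix` (`CoprimeSix.stub_reach_of_pairedOrSigmaFive`):

* four pairs `s = Q + (-Q)`, `Q` zero-free: `P :=` the pairs `{a, -a}`, `a ∈ Q` (first component of
  the supply, Aoki 1987 Thm. 1-1), `N := 0`, and `Σ_{a ∈ Q} {a, -a} = Q + (-Q)`
  (`FermatCharacter.sum_map_pair`);
* Aoki's standard octuple `s = σ_{7,A} = {A + j (m/7) : j < 7} + {-7A}` (`7 ∣ m`, `7A ≠ 0`):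
  `P := {s}`, `N := 0`; `s` is VERBATIM the fourth component of the supply with `p = 7`, `a = A`
  (after `((7 : ℕ) : ZMod m) = 7`), and Aoki's side condition `2 < (m/7)/(⟨A⟩, m/7)` holds
  (`two_lt_div_gcd_of_progression_ne_zero_of_dvd`, stated for a general divisor `p` of `m`): the
  quotient `(m/p)/(⟨A⟩, m/p)` divides `m`, hence is coprime to `6`, hence odd; and it is not `1`, for
  otherwise `m/p ∣ ⟨A⟩`, `⟨A⟩ = (m/p) k`, and the progression point `A + j (m/p)` with
  `j ≡ -k (mod p)` would be `(m/p) · p · c = 0` in `ℤ/m` — but a Hodge multiset is zero-free.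

Everything here is PROVED (no `sorry`, no new definition, no new named fact); only Mathlib and the
`IsHodgeMultiset` vocabulary of `FermatShiodaCondition` (zero-freeness `hs.1.1`) enter. The general-`p`
side-condition lemma is new (the landed `two_lt_div_gcd_of_progression_ne_zero` is the case `p = 5`).

References: [Aoki1987] N. Aoki, Some new algebraic cycles on Fermat varieties, J. Math. Soc. Japan 39
(1987) 385–396, Thm. 1-1 (pairs) and Thm. 2-1 (standard elements, p. 388).
-/

-- the line's stubs all live in `…CancelByAnyClaimLattice.CoprimeSix`, a namespace not matching this file's name
set_option linter.dupNamespace false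

noncomputable section

open Finset
open Literature.AlgebraicGeometry.HodgeTheory Literature.AlgebraicGeometry.HodgeTheory.FermatCharacter

namespace Summit.HodgeConjecture.HodgeConjecture.Theorems.CancelByAnyClaimLattice.CoprimeSix

/-- `Supply[M]` — the printed supply of level `M` (local notation of the line, verbatim). -/
local notation3 (prettyPrint := false) "Supply[" M "]" =>
  ({s : Multiset (ZMod M) | ∃ a : ZMod M, a ≠ 0 ∧ s = ({a, -a} : Multiset (ZMod M))} ∪
    {s : Multiset (ZMod M) | IsHodgeMultiset s ∧ Multiset.card s = 4} ∪
    {s : Multiset (ZMod M) | IsHodgeMultiset s ∧ IsSemiDecomposable s} ∪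
    {s : Multiset (ZMod M) | ∃ (p : ℕ) (a : ZMod M), p.Prime ∧ p ≠ 2 ∧ p ∣ M ∧
        2 < (M / p) / Nat.gcd (ZMod.val a) (M / p) ∧
        s = Multiset.map (fun j : ℕ => a + (j : ZMod M) * ((M / p : ℕ) : ZMod M)) (Multiset.range p) +
              {-((p : ZMod M) * a)}} : Set (Multiset (ZMod M)))

/-- `Reach[M, s]` (local notation of the line, verbatim). -/
local notation3 (prettyPrint := false) "Reach[" M ", " s "]" =>
  ∃ P N : Multiset (Multiset (ZMod M)),
    (∀ u ∈ P, u ∈ Supply[M]) ∧ (∀ u ∈ N, u ∈ Supply[M]) ∧ s + Multiset.sum N = Multiset.sum P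

/-- **Aoki's side condition for a zero-free `p`-progression.** If `m` is coprime to `6`, `0 < p`,
`p ∣ m`, and none of the `p` points `A + j (m/p)`, `j < p`, of `ℤ/m` vanishes, then
`2 < (m/p) / (⟨A⟩, m/p)`: the quotient divides `m`, so it is coprime to `6`, hence odd; and it is not
`1`, since `m/p ∣ ⟨A⟩`, say `⟨A⟩ = (m/p) k`, would make the point with `j ≡ -k (mod p)` equal to
`(m/p) (k + j) = m c = 0`. (Aoki's condition `d/(⟨a⟩, d) > 2` on the standard elements `σ_{p,a}`,
`d = m/p`; the case `p = 5` is `two_lt_div_gcd_of_progression_ne_zero`.)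
[cite: Aoki1987, Thm. 1-1 and Thm. 2-1 (p. 388)] -/
theorem two_lt_div_gcd_of_progression_ne_zero_of_dvd {m : ℕ} [NeZero m] (hm : m.Coprime 6) {p : ℕ}
    (hp : 0 < p) (hpm : p ∣ m) {A : ZMod m}
    (hA : ∀ j : ℕ, j < p → A + (j : ZMod m) * ((m / p : ℕ) : ZMod m) ≠ 0) :
    2 < (m / p) / Nat.gcd A.val (m / p) := by
  have hmd : m / p * p = m := Nat.div_mul_cancel hpm
  have hgd : Nat.gcd A.val (m / p) ∣ m / p := Nat.gcd_dvd_right _ _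
  -- the quotient divides `m`, hence is coprime to `6`, hence odd
  have hq_dvd : (m / p) / Nat.gcd A.val (m / p) ∣ m :=
    (Nat.div_dvd_of_dvd hgd).trans (Nat.div_dvd_of_dvd hpm)
  have hq_cop : ((m / p) / Nat.gcd A.val (m / p)).Coprime 6 := Nat.Coprime.coprime_dvd_left hq_dvd hm
  have hodd : Odd ((m / p) / Nat.gcd A.val (m / p)) :=
    Nat.coprime_two_right.1 (Nat.Coprime.coprime_dvd_right (by norm_num : 2 ∣ 6) hq_cop)
  -- the quotient is not `1`: otherwise `m / p ∣ ⟨A⟩` and the progression would pass through `0`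
  have hq1 : (m / p) / Nat.gcd A.val (m / p) ≠ 1 := by
    intro h1
    have hdA : m / p ∣ A.val := by
      rw [← Nat.eq_of_dvd_of_div_eq_one hgd h1]
      exact Nat.gcd_dvd_left _ _
    obtain ⟨k, hk⟩ := hdA
    obtain ⟨c, hc⟩ : p ∣ k + (p - k % p) % p := by
      refine Nat.dvd_of_mod_eq_zero ?_
      rcases Nat.eq_zero_or_pos (k % p) with h0 | h0
      · rw [h0, Nat.sub_zero, Nat.mod_self, add_zero, h0]
      · rw [Nat.mod_eq_of_lt (Nat.sub_lt hp h0), Nat.add_mod, Nat.mod_eq_of_lt (Nat.sub_lt hp h0),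
          Nat.add_sub_of_le (Nat.mod_lt k hp).le, Nat.mod_self]
    have e : m / p * k + (p - k % p) % p * (m / p) = m * c :=
      calc m / p * k + (p - k % p) % p * (m / p) = m / p * (k + (p - k % p) % p) := by ring
        _ = m / p * p * c := by rw [hc, mul_assoc]
        _ = m * c := by rw [hmd]
    refine hA ((p - k % p) % p) (Nat.mod_lt _ hp) ?_
    have key : A + (((p - k % p) % p : ℕ) : ZMod m) * ((m / p : ℕ) : ZMod m) =
        ((m / p * k + (p - k % p) % p * (m / p) : ℕ) : ZMod m) := by
      rw [← ZMod.natCast_zmod_val A, hk]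
      push_cast
      ring
    rw [key, e, Nat.cast_mul, ZMod.natCast_self, zero_mul]
  -- an odd natural number other than `1` exceeds `2`
  obtain ⟨r, hr⟩ := hodd
  omega

/-- **G8-R `stub_reach_of_pairedOrSigmaSeven` — both shapes of a Hodge octuple at a level prime to
`30` are ℤ-reachable from the printed supply at their own level.** Four pairs `Q + (-Q)` (`Q`
zero-free): `P :=` the pairs `{a, -a}`, `a ∈ Q` (first component of the supply, Aoki Thm. 1-1),
`N := 0` (`sum_map_pair`). Aoki's `σ_{7,A} = {A + j (m/7) : j < 7} + {-7A}` with `7 ∣ m`, `7A ≠ 0`: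
`P := {s}`, `N := 0`, `s` being verbatim the fourth component of the supply with `p = 7`, `a = A`
(after `((7 : ℕ) : ZMod m) = 7`, `Nat.cast_ofNat`); Aoki's side condition `2 < (m/7)/(⟨A⟩, m/7)` is
`two_lt_div_gcd_of_progression_ne_zero_of_dvd` (with `m` coprime to `6 ∣ 30`), the seven progression
points being entries of the zero-free Hodge multiset `s`. (The hypotheses `#s = 8` and `7A ≠ 0` are not
used.) [cite: Aoki1987, Thm. 1-1 and Thm. 2-1 (p. 388)] -/
theorem stub_reach_of_pairedOrSigmaSeven : ∀ (m : ℕ) [NeZero m], m.Coprime 30 → ∀ s : Multiset (ZMod m), IsHodgeMultiset s → Multiset.card s = 8 → ((∃ Q : Multiset (ZMod m), (∀ a ∈ Q, a ≠ 0) ∧ s = Q + Q.map (fun a ↦ -a)) ∨ (7 ∣ m ∧ ∃ A : ZMod m, (7 : ZMod m) * A ≠ 0 ∧ s = (Multiset.range 7).map (fun i : ℕ ↦ A + (i : ZMod m) * ((m / 7 : ℕ) : ZMod m)) + {-((7 : ZMod m) * A)})) → Reach[m, s] := by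
  intro m _ hm s hs _ h
  rcases h with ⟨Q, hQ, hsQ⟩ | ⟨h7, A, _, hsA⟩
  · -- four pairs: `P :=` the pairs of `Q`, `N := 0`
    refine ⟨Q.map fun a ↦ ({a, -a} : Multiset (ZMod m)), 0, fun u hu ↦ ?_,
      fun u hu ↦ absurd hu (Multiset.notMem_zero u), ?_⟩
    · obtain ⟨a, ha, rfl⟩ := Multiset.mem_map.1 hu
      exact Or.inl (Or.inl (Or.inl ⟨a, hQ a ha, rfl⟩))
    · rw [Multiset.sum_zero, add_zero, sum_map_pair]
      exact hsQ
  · -- `σ_{7,A}`: `P := {s}`, `N := 0`, `s` in the fourth component with `p = 7`, `a = A`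
    have hm6 : m.Coprime 6 := Nat.Coprime.coprime_dvd_right (by norm_num : 6 ∣ 30) hm
    have hA0 : ∀ j : ℕ, j < 7 → A + (j : ZMod m) * ((m / 7 : ℕ) : ZMod m) ≠ 0 := fun j hj ↦
      hs.1.1 _ (by
        rw [hsA]
        exact Multiset.mem_add.2 (Or.inl (Multiset.mem_map.2 ⟨j, Multiset.mem_range.2 hj, rfl⟩)))
    refine ⟨{s}, 0, fun u hu ↦ ?_, fun u hu ↦ absurd hu (Multiset.notMem_zero u), by simp⟩
    rw [Multiset.mem_singleton] at hu
    rw [hu, hsA]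
    refine Or.inr ⟨7, A, by decide, by norm_num, h7,
      two_lt_div_gcd_of_progression_ne_zero_of_dvd hm6 (by norm_num) h7 hA0, ?_⟩
    simp only [Nat.cast_ofNat]

end Summit.HodgeConjecture.HodgeConjecture.Theorems.CancelByAnyClaimLattice.CoprimeSix

end
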